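import Mathlib.Analysis.SpecialFunctions.Log.Deriv
import Mathlib.Analysis.SpecialFunctions.Pow.Real
import HarnessLib

/-!
# `RigorousRGSmallParameter` (Slade, Theorem 1.4.1): Lemma 8.1.1 and the identification of the
# exponent `γ̂ε/α` at the mass scale — the real analysis of §8.1 over the renormalisation-group flow

Companion ("proof architecture") file of
`Literature/Barriers/CriticalPhenomena/RigorousRGSmallParameter.lean` (the barrier is literally
`LongRangePhi4.Slade2017_thm141`, Slade's Theorem 1.4.1, first display, `n ≥ 1`). Source: G. Slade,
*Critical exponents for long-range `O(n)` models below the upper critical dimension*, Commun.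
Math. Phys. 358 (2018) 343–436, arXiv:1611.06169v4 (read from the TeX source; theorem numbers are
those of the published numbering, displays are located by their position in the text).

## Where this sits in the printed proof

The sibling files reduce the barrier to the named fact `LongRangePhi4.Slade2017_prop822`
(`RigorousRGSmallParameterSusceptibilityLimits.lean`): Proposition 8.2.2 with the two-sided bound
"`c⁻¹m^{-4+2γ̂ε/α+cε²} ≤ -∂χ/∂ν(ν*) ≤ cm^{-4+2γ̂ε/α-cε²}`" of the first display after Remark 8.2.3,
`γ̂ = (n+2)/(n+8)` (§5.1). In the printed proof that bound is the last display of the proof of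
Proposition 8.2.2,
"`ν'_∞ ≍ P_{j_m} e^{O(ε²j_m)} ≍ (g_{j_m}/g)^γ̂ e^{O(ε²j_m)} ≍ L^{-γ̂εj_m} e^{O(ε²j_m)}
≍ m^{2γ̂ε/α+O(ε²)}`" (with `χ̂' = -ν'_∞/m⁴`), and it rests on three ingredients:

1. **Lemma 8.1.1** — for `m² ∈ (0,δ]`, `g ∈ [63/64 s̄, 65/64 s̄]` and `j ≤ j_m`,
   `P_j = (1+O(s̄)) (L^{-εj}s_j/s_0)^γ̂ e^{O(s̄²j)} = (1+O(s̄)) (g_j/g_0)^γ̂ e^{O(s̄²j)}`, where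
   `P_j = ∏_{k=0}^{j-1} (1 - γ̂β_k s_k)` (the display defining `P_j` at the start of §8.1, with
   `s_0 = g`). Its printed proof uses exactly four inputs: `β_k, β^:_k = O(1)` (Lemma 5.2.1); the summability of `β^:_k - β_k` below the
   mass scale (Lemma 5.2.3: `|β^:_j - β_j| ≤ O(L^{-zj} + L^{-z(j_m-j)})`); `s_k = s̄ - y_k ≍ s̄`
   (Lemma 7.2.7: `|y_j| ≤ s̄/31`); and the flow equation
   "`s_{k+1} = L^ε(1 - β^:_k s_k)s_k + r_{s,k}`, `r_{s,k} = O(s̄³)`" (the display in the proof of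
   Lemma 8.1.1: the `y`-equation of Lemma 7.1.1 written for `s` rather than `y`), followed by
   "Taylor's theorem"
   (`(1 - γ̂β^:_k s_k) = (1 - β^:_k s_k)^γ̂ (1 + O(s̄²))`).
2. **The mass scale** `j_m = ⌈f_m⌉`, `f_m = 1 + α⁻¹ log_L m⁻²` (§3.4, the display defining the
   mass scale), for which `L^{-2α}m² ≤ L^{-αj_m} ≤ L^{-α}m²` (cf. the display following it) and `j_m ≤ 2 + log m⁻²/(α log L)`: this is what
   converts `L^{-γ̂εj_m}` into `m^{2γ̂ε/α}` and `e^{O(ε²j_m)}` into `m^{O(ε²)}` (constants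
   depending on `L`, which is fixed before `ε`).
3. `ν'_∞ = P_{j_m} e^{O(s̄²j_m)}(1+O(s̄))` (Theorem 7.3.1, Corollary 8.1.3, Lemma 8.1.4) and
   `s̄ = a⁻¹(1 - L^{-ε}) = O(ε)` (§5.4) — outputs of the renormalisation-group flow proper
   (Theorems 6.3.1, 7.2.2, 7.3.1), NOT proved here.

## What this file proves (everything; no named fact is introduced)

* `Slade2017_lem811_step`, `Slade2017_lem811_log`, `Slade2017_lem811` — **Lemma 8.1.1 with its
  four inputs as explicit hypotheses** on real sequences `s, β, β^:, r : ℕ → ℝ` up to a horizon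
  `Jm` (the mass scale): in logarithmic form
  `|log P_j - γ̂(log s_j - log s_0 - j log L^ε)| ≤ 4S s̄ + (16B² + 4R) s̄² j` for `j ≤ Jm`, where
  `B` bounds `|β_k|, |β^:_k|`, `S` bounds `Σ_{k<Jm} |β^:_k - β_k|`, `R s̄³` bounds `|r_k|`, under the
  smallness conditions `2Bs̄ ≤ ¼`, `2Rs̄² ≤ ¼` ("`ε` small depending on `L`") and
  `s_k ∈ [s̄/2, 2s̄]` (weaker than the printed `s_k ∈ [30/31 s̄, 32/31 s̄]`); and in the printed
  product form `e^{-E_j}(L^{-εj}s_j/s_0)^γ̂ ≤ P_j ≤ e^{E_j}(L^{-εj}s_j/s_0)^γ̂`,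
  `E_j = 4Ss̄ + (16B²+4R)s̄²j` (so `e^{±4Ss̄} = 1 + O(s̄)` and `e^{±(16B²+4R)s̄²j} = e^{O(s̄²j)}`).
  The proof is the printed one, organised through logarithms instead of the product of Taylor
  factors: `log(1-γ̂β_k s_k) - γ̂ log(s_{k+1}/(L^ε s_k))` is split into the `β^: - β` term, the
  "Taylor" term `log(1-γ̂w) - γ̂ log(1-w) = O(w²)`, and the remainder term from `r_{s,k}`.
  `Slade2017_lem811_g` is the second equality of the lemma given
  "`g_j = L^{-εj}s_j(1+O(s̄))`" (by the change of variables of §5.3) as the hypothesis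
  `|log g_k - log(L^{-εk}s_k)| ≤ Ks̄`.
* `massScaleReal`, `massScale`, `Slade2017_massScale_bounds` — the mass scale of §3.4 and the
  bounds of item 2.
* `Slade2017_exponent_identification` — the arithmetic of the last display of the proof of
  Proposition 8.2.2: if `ν > 0` satisfies `|log ν + γ̂ ε j log L| ≤ A + cε²j` at a scale `j` with
  `f_m ≤ j ≤ f_m + 1` (in particular at `j = j_m`), then
  `C⁻¹ (m²)^{γ̂ε/α + c'ε²} ≤ ν ≤ C (m²)^{γ̂ε/α - c'ε²}` with the explicit
  `C = exp(A + 2cε² + 2γ̂ε log L)`, `c' = c/(α log L)`.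
* `Slade2017_prop822_exponent_of_flow` — the composite: under the hypotheses of Lemma 8.1.1 up to
  `Jm = j_m`, `s̄ ≤ c₀ε`, `ε ≤ 1`, and `|log ν - log P_{j_m}| ≤ A₁ + c₁s̄²j_m` (item 3 as a
  hypothesis), the two-sided power bound on `ν` with constants uniform in `m² ∈ (0,1]` and
  `ε ∈ (0,1]` (depending on `L, α, B, S, R, c₀, A₁, c₁`) — i.e. the display after Remark 8.2.3
  up to the factor `m⁻⁴` and the sign, GIVEN the flow.

Ledger effect: none on the trust base of the barrier's reduction chain (`Slade2017_prop822`
remains the named fact; its discharge is the renormalisation-group theory of §5–§8.1 resting on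
[BS-rg-step]); this file makes the real-analysis part of §8.1 that produces the first-order
exponent `γ̂ε/α` unconditional on its inputs. Not treated: Lemma 8.1.2–8.1.5, Corollary 8.1.6
(flow of the `ν₀`-derivatives, which need the `𝒲_j`/`T_φ` norms), Theorem 7.3.1, `n = 0`.
-/

noncomputable section

namespace Literature.Barriers.CriticalPhenomena

open Finset Real

namespace LongRangePhi4

/-! ### Two elementary logarithm estimates -/

/-- `|log(1-x) + x| ≤ 2x²` for `|x| ≤ ½` (the `n = 1` case of Mathlib's
`Real.abs_log_sub_add_sum_range_le`). [folklore] -/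
theorem abs_log_one_sub_add_self_le {x : ℝ} (hx : |x| ≤ 1/2) :
    |Real.log (1 - x) + x| ≤ 2 * x ^ 2 := by
  have h1 : |x| < 1 := lt_of_le_of_lt hx (by norm_num)
  have h := Real.abs_log_sub_add_sum_range_le h1 1
  simp only [Finset.sum_range_one, Nat.cast_zero, zero_add, pow_one, div_one] at h
  rw [add_comm] at h
  calc |Real.log (1 - x) + x| ≤ |x| ^ 2 / (1 - |x|) := h
    _ ≤ |x| ^ 2 / (1/2) := by
        apply div_le_div_of_nonneg_left (by positivity) (by norm_num) (by linarith)
    _ = 2 * x ^ 2 := by rw [sq_abs]; ring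

/-- The logarithm is `a⁻¹`-Lipschitz on `[a,∞)`: `|log u - log v| ≤ |u-v|/a` for `a ≤ u, v`,
`a > 0`. [folklore] -/
theorem abs_log_sub_log_le_div {a u v : ℝ} (ha : 0 < a) (hu : a ≤ u) (hv : a ≤ v) :
    |Real.log u - Real.log v| ≤ |u - v| / a := by
  have hu0 : 0 < u := lt_of_lt_of_le ha hu
  have hv0 : 0 < v := lt_of_lt_of_le ha hv
  rw [abs_sub_le_iff]
  constructor
  · rw [← Real.log_div hu0.ne' hv0.ne']
    calc Real.log (u / v) ≤ u / v - 1 := Real.log_le_sub_one_of_pos (div_pos hu0 hv0)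
      _ = (u - v) / v := by field_simp
      _ ≤ |u - v| / v := by gcongr; exact le_abs_self _
      _ ≤ |u - v| / a := div_le_div_of_nonneg_left (abs_nonneg _) ha hv
  · rw [← Real.log_div hv0.ne' hu0.ne']
    calc Real.log (v / u) ≤ v / u - 1 := Real.log_le_sub_one_of_pos (div_pos hv0 hu0)
      _ = (v - u) / u := by field_simp
      _ ≤ |u - v| / u := by gcongr; rw [abs_sub_comm]; exact le_abs_self _
      _ ≤ |u - v| / a := div_le_div_of_nonneg_left (abs_nonneg _) ha hu

/-! ### Lemma 8.1.1: `P_j` versus `(L^{-εj}s_j/s_0)^γ̂` -/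

/-- One scale of the proof of Lemma 8.1.1. With `x = β_k s_k`, `w = β^:_k s_k` and
`s_{k+1}/(L^ε s_k) = 1 - w + e`, `e = r_k/(L^ε s_k)` (from the flow equation
`s_{k+1} = L^ε(1-β^:_k s_k)s_k + r_{s,k}` displayed in the proof of Lemma 8.1.1):
`|log(1-γ̂x) - γ̂ log(s_{k+1}/(L^ε s_k))| ≤ 4s̄|β^:_k-β_k| + (16B²+4R)s̄²` — the three printed
ingredients `f_k = O(|β^:_k-β_k| s̄)`, "Taylor's theorem" `(1-γ̂w) = (1-w)^γ̂(1+O(w²))`, and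
`r_{s,k}/(L^ε s_k) = O(s̄²)`. Hypotheses: `γ̂ ∈ [0,1]`, `L^ε ≥ 1` (`lam`), `s_k ∈ [s̄/2, 2s̄]`,
`s_{k+1} ≥ s̄/2`, `|β_k|, |β^:_k| ≤ B`, `|r_k| ≤ Rs̄³`, `2Bs̄ ≤ ¼`, `2Rs̄² ≤ ¼`.
[cite: Slade2017, Lemma 8.1.1 (proof)] -/
theorem Slade2017_lem811_step {γh lam sbar B R βk βWk sk sk1 rk : ℝ}
    (hγ0 : 0 ≤ γh) (hγ1 : γh ≤ 1) (hlam : 1 ≤ lam) (hsbar : 0 < sbar) (hB : 0 ≤ B) (hR : 0 ≤ R)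
    (hBs : 2 * B * sbar ≤ 1 / 4) (hRs : 2 * R * sbar ^ 2 ≤ 1 / 4)
    (hsk : sbar / 2 ≤ sk) (hsk' : sk ≤ 2 * sbar) (hsk1 : sbar / 2 ≤ sk1)
    (hβk : |βk| ≤ B) (hβWk : |βWk| ≤ B)
    (hrec : sk1 = lam * (1 - βWk * sk) * sk + rk) (hrk : |rk| ≤ R * sbar ^ 3) :
    |Real.log (1 - γh * βk * sk) - γh * (Real.log sk1 - Real.log sk - Real.log lam)|
      ≤ 4 * sbar * |βWk - βk| + (16 * B ^ 2 + 4 * R) * sbar ^ 2 := by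
  -- the three small quantities
  set x := βk * sk with hx_def
  set w := βWk * sk with hw_def
  have hsk0 : 0 < sk := by linarith
  have hsk10 : 0 < sk1 := by linarith
  have hlam0 : 0 < lam := by linarith
  have hx : |x| ≤ 1 / 4 := by
    rw [hx_def, abs_mul, abs_of_pos hsk0]
    calc |βk| * sk ≤ B * (2 * sbar) := mul_le_mul hβk hsk' hsk0.le hB
      _ = 2 * B * sbar := by ring
      _ ≤ 1 / 4 := hBs
  have hw : |w| ≤ 1 / 4 := by
    rw [hw_def, abs_mul, abs_of_pos hsk0]
    calc |βWk| * sk ≤ B * (2 * sbar) := mul_le_mul hβWk hsk' hsk0.le hB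
      _ = 2 * B * sbar := by ring
      _ ≤ 1 / 4 := hBs
  set e := rk / (lam * sk) with he_def
  have hlamsk : 0 < lam * sk := mul_pos hlam0 hsk0
  have he : |e| ≤ 2 * R * sbar ^ 2 := by
    rw [he_def, abs_div, abs_of_pos hlamsk, div_le_iff₀ hlamsk]
    calc |rk| ≤ R * sbar ^ 3 := hrk
      _ = 2 * R * sbar ^ 2 * (1 * (sbar / 2)) := by ring
      _ ≤ 2 * R * sbar ^ 2 * (lam * sk) := by
          apply mul_le_mul_of_nonneg_left _ (by positivity)
          exact mul_le_mul hlam hsk (by linarith) hlam0.le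
  have he' : |e| ≤ 1 / 4 := he.trans hRs
  -- the ratio `s_{k+1}/(L^ε s_k) = 1 - w + e`
  have hratio : sk1 / (lam * sk) = 1 - w + e := by
    rw [he_def, hrec, hw_def]
    field_simp
  have hlogdiff : Real.log sk1 - Real.log sk - Real.log lam = Real.log (1 - w + e) := by
    rw [← hratio, Real.log_div hsk10.ne' hlamsk.ne', Real.log_mul hlam0.ne' hsk0.ne']
    ring
  rw [hlogdiff]
  -- abbreviations for absolute-value facts
  have hxl := neg_abs_le x
  have hxu := le_abs_self x
  have hwl := neg_abs_le w
  have hwu := le_abs_self w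
  have hel := neg_abs_le e
  have heu := le_abs_self e
  have hγx : |γh * x| ≤ 1 / 4 := by
    rw [abs_mul, abs_of_nonneg hγ0]
    calc γh * |x| ≤ 1 * (1 / 4) := mul_le_mul hγ1 hx (abs_nonneg _) zero_le_one
      _ = 1 / 4 := by ring
  have hγw : |γh * w| ≤ 1 / 4 := by
    rw [abs_mul, abs_of_nonneg hγ0]
    calc γh * |w| ≤ 1 * (1 / 4) := mul_le_mul hγ1 hw (abs_nonneg _) zero_le_one
      _ = 1 / 4 := by ring
  have hγxl := neg_abs_le (γh * x)
  have hγxu := le_abs_self (γh * x)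
  have hγwl := neg_abs_le (γh * w)
  have hγwu := le_abs_self (γh * w)
  -- Term A: `|log(1-γx) - log(1-γw)| ≤ 2γ|x-w| ≤ 4 sbar |βW-β|`
  have hA : |Real.log (1 - γh * x) - Real.log (1 - γh * w)| ≤ 4 * sbar * |βWk - βk| := by
    have h1 : (1 : ℝ) / 2 ≤ 1 - γh * x := by linarith
    have h2 : (1 : ℝ) / 2 ≤ 1 - γh * w := by linarith
    calc |Real.log (1 - γh * x) - Real.log (1 - γh * w)|
        ≤ |(1 - γh * x) - (1 - γh * w)| / (1 / 2) := abs_log_sub_log_le_div (by norm_num) h1 h2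
      _ = 2 * (γh * (|βWk - βk| * sk)) := by
          have : (1 - γh * x) - (1 - γh * w) = γh * ((βWk - βk) * sk) := by
            rw [hx_def, hw_def]; ring
          rw [this, abs_mul, abs_of_nonneg hγ0, abs_mul, abs_of_pos hsk0]
          ring
      _ ≤ 2 * (1 * (|βWk - βk| * (2 * sbar))) := by
          gcongr
      _ = 4 * sbar * |βWk - βk| := by ring
  -- Term B: `|log(1-γw) - γ log(1-w)| ≤ 4 w² ≤ 16 B² sbar²`
  have hB' : |Real.log (1 - γh * w) - γh * Real.log (1 - w)| ≤ 16 * B ^ 2 * sbar ^ 2 := by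
    have t1 := abs_log_one_sub_add_self_le (show |γh * w| ≤ 1 / 2 by linarith)
    have t2 := abs_log_one_sub_add_self_le (show |w| ≤ 1 / 2 by linarith)
    have hsplit : Real.log (1 - γh * w) - γh * Real.log (1 - w)
        = (Real.log (1 - γh * w) + γh * w) - γh * (Real.log (1 - w) + w) := by ring
    rw [hsplit]
    have hw2 : w ^ 2 ≤ (2 * B * sbar) ^ 2 := by
      have : |w| ≤ 2 * B * sbar := by
        rw [hw_def, abs_mul, abs_of_pos hsk0]
        calc |βWk| * sk ≤ B * (2 * sbar) := mul_le_mul hβWk hsk' hsk0.le hB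
          _ = 2 * B * sbar := by ring
      calc w ^ 2 = |w| ^ 2 := (sq_abs w).symm
        _ ≤ (2 * B * sbar) ^ 2 := by gcongr
    calc |(Real.log (1 - γh * w) + γh * w) - γh * (Real.log (1 - w) + w)|
        ≤ |Real.log (1 - γh * w) + γh * w| + |γh * (Real.log (1 - w) + w)| := abs_sub _ _
      _ ≤ 2 * (γh * w) ^ 2 + γh * (2 * w ^ 2) := by
          rw [abs_mul, abs_of_nonneg hγ0]
          gcongr
      _ ≤ 2 * w ^ 2 + 1 * (2 * w ^ 2) := by
          have hw2nn : 0 ≤ w ^ 2 := sq_nonneg w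
          have hγ2 : γh ^ 2 ≤ 1 := pow_le_one₀ hγ0 hγ1
          have h1 : (γh * w) ^ 2 ≤ w ^ 2 := by
            rw [mul_pow]; exact mul_le_of_le_one_left hw2nn hγ2
          have h2 : γh * (2 * w ^ 2) ≤ 1 * (2 * w ^ 2) :=
            mul_le_mul_of_nonneg_right hγ1 (by positivity)
          linarith
      _ = 4 * w ^ 2 := by ring
      _ ≤ 4 * (2 * B * sbar) ^ 2 := by gcongr
      _ = 16 * B ^ 2 * sbar ^ 2 := by ring
  -- Term C: `γ |log(1-w) - log(1-w+e)| ≤ 2|e| ≤ 4 R sbar²`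
  have hC : |γh * Real.log (1 - w) - γh * Real.log (1 - w + e)| ≤ 4 * R * sbar ^ 2 := by
    have h1 : (1 : ℝ) / 2 ≤ 1 - w := by linarith
    have h2 : (1 : ℝ) / 2 ≤ 1 - w + e := by linarith
    rw [← mul_sub, abs_mul, abs_of_nonneg hγ0]
    calc γh * |Real.log (1 - w) - Real.log (1 - w + e)|
        ≤ 1 * (|(1 - w) - (1 - w + e)| / (1 / 2)) :=
          mul_le_mul hγ1 (abs_log_sub_log_le_div (by norm_num) h1 h2) (abs_nonneg _) zero_le_one
      _ = 2 * |e| := by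
          have : (1 - w) - (1 - w + e) = -e := by ring
          rw [this, abs_neg]; ring
      _ ≤ 2 * (2 * R * sbar ^ 2) := by gcongr
      _ = 4 * R * sbar ^ 2 := by ring
  -- assemble
  have hsplit : Real.log (1 - γh * βk * sk) - γh * Real.log (1 - w + e)
      = (Real.log (1 - γh * x) - Real.log (1 - γh * w))
        + (Real.log (1 - γh * w) - γh * Real.log (1 - w))
        + (γh * Real.log (1 - w) - γh * Real.log (1 - w + e)) := by
    rw [hx_def, mul_assoc]; ring
  rw [hsplit]
  calc _ ≤ |(Real.log (1 - γh * x) - Real.log (1 - γh * w))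
        + (Real.log (1 - γh * w) - γh * Real.log (1 - w))|
        + |γh * Real.log (1 - w) - γh * Real.log (1 - w + e)| := abs_add_le _ _
    _ ≤ (|Real.log (1 - γh * x) - Real.log (1 - γh * w)|
        + |Real.log (1 - γh * w) - γh * Real.log (1 - w)|)
        + |γh * Real.log (1 - w) - γh * Real.log (1 - w + e)| := by
          gcongr; exact abs_add_le _ _
    _ ≤ (4 * sbar * |βWk - βk| + 16 * B ^ 2 * sbar ^ 2) + 4 * R * sbar ^ 2 := by
          gcongr
    _ = 4 * sbar * |βWk - βk| + (16 * B ^ 2 + 4 * R) * sbar ^ 2 := by ring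

/-- `P_j = ∏_{k=0}^{j-1} (1 - γ̂ β_k s_k)` for `j ≤ j_m` — the product defined at the start of §8.1,
governing the flow of the `ν₀`-derivative `μ'_j = L^{αj}P_j e^{O(s̄²j)}` (Lemma 8.1.2). (Above the
mass scale the printed `P_j` is frozen at `P_{j_m}`; only `j ≤ j_m` is used here.)
[cite: Slade2017, §8.1 (display defining `P_j`, before Lemma 8.1.1)] -/
def flowP (γh : ℝ) (β s : ℕ → ℝ) (j : ℕ) : ℝ := ∏ k ∈ range j, (1 - γh * β k * s k)

/-- `P_0 = 1` (empty product). [cite: Slade2017, §8.1 (display defining `P_j`)] -/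
theorem flowP_zero (γh : ℝ) (β s : ℕ → ℝ) : flowP γh β s 0 = 1 := by
  simp [flowP]

/-- `P_{j+1} = P_j (1 - γ̂β_j s_j)`. [cite: Slade2017, §8.1 (display defining `P_j`)] -/
theorem flowP_succ (γh : ℝ) (β s : ℕ → ℝ) (j : ℕ) :
    flowP γh β s (j + 1) = flowP γh β s j * (1 - γh * β j * s j) := by
  simp [flowP, Finset.prod_range_succ]

/-- **Slade, Lemma 8.1.1 (logarithmic form, inputs explicit).** Let `γ̂ ∈ [0,1]`, `lam = L^ε ≥ 1`,
`s̄ > 0`, and sequences `s, β, β^: (= βW), r` with, up to the horizon `Jm` (the mass scale):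
`s_k ∈ [s̄/2, 2s̄]` (`k ≤ Jm`; printed: `s_k = s̄ - y_k`, `|y_k| ≤ s̄/31`, Lemma 7.2.7),
`|β_k|, |β^:_k| ≤ B` (Lemma 5.2.1), `Σ_{k<Jm}|β^:_k - β_k| ≤ S` (Lemma 5.2.3), the flow equation
`s_{k+1} = lam(1-β^:_k s_k)s_k + r_k` with `|r_k| ≤ Rs̄³` (proof of Lemma 8.1.1), and `2Bs̄ ≤ ¼`,
`2Rs̄² ≤ ¼`.
Then for `j ≤ Jm`, `|log P_j - γ̂(log s_j - log s_0 - j log lam)| ≤ 4Ss̄ + (16B²+4R)s̄²j`, i.e.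
`P_j = (1+O(s̄))(lam^{-j}s_j/s_0)^γ̂ e^{O(s̄²j)}` with the printed uniformity (constants independent
of `j`, `Jm`, `s̄`). [cite: Slade2017, Lemma 8.1.1] -/
theorem Slade2017_lem811_log
    {γh lam sbar B S R : ℝ} {β βW s r : ℕ → ℝ} {Jm : ℕ}
    (hγ0 : 0 ≤ γh) (hγ1 : γh ≤ 1) (hlam : 1 ≤ lam) (hsbar : 0 < sbar)
    (hB : 0 ≤ B) (hR : 0 ≤ R)
    (hBs : 2 * B * sbar ≤ 1 / 4) (hRs : 2 * R * sbar ^ 2 ≤ 1 / 4)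
    (hs : ∀ k ≤ Jm, sbar / 2 ≤ s k ∧ s k ≤ 2 * sbar)
    (hβ : ∀ k < Jm, |β k| ≤ B) (hβW : ∀ k < Jm, |βW k| ≤ B)
    (hdiff : ∑ k ∈ range Jm, |βW k - β k| ≤ S)
    (hrec : ∀ k < Jm, s (k + 1) = lam * (1 - βW k * s k) * s k + r k)
    (hr : ∀ k < Jm, |r k| ≤ R * sbar ^ 3) :
    ∀ j ≤ Jm, |Real.log (flowP γh β s j)
        - γh * (Real.log (s j) - Real.log (s 0) - j * Real.log lam)|
      ≤ 4 * S * sbar + (16 * B ^ 2 + 4 * R) * sbar ^ 2 * j := by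
  intro j hj
  -- positivity of the factors
  have hfac : ∀ k < j, (1 : ℝ) / 2 ≤ 1 - γh * β k * s k := by
    intro k hk
    have hkJ : k < Jm := lt_of_lt_of_le hk hj
    have hsk := hs k hkJ.le
    have hsk0 : 0 < s k := by linarith [hsk.1]
    have h1 : |γh * β k * s k| ≤ 1 / 4 := by
      rw [abs_mul, abs_mul, abs_of_nonneg hγ0, abs_of_pos hsk0]
      calc γh * |β k| * s k ≤ 1 * B * (2 * sbar) := by
            apply mul_le_mul (mul_le_mul hγ1 (hβ k hkJ) (abs_nonneg _) zero_le_one) hsk.2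
              hsk0.le (by positivity)
        _ = 2 * B * sbar := by ring
        _ ≤ 1 / 4 := hBs
    have := le_abs_self (γh * β k * s k)
    linarith
  -- `log P_j` as a sum
  have hlogP : Real.log (flowP γh β s j) = ∑ k ∈ range j, Real.log (1 - γh * β k * s k) := by
    unfold flowP
    rw [Real.log_prod]
    intro k hk
    have := hfac k (Finset.mem_range.mp hk)
    linarith
  -- the telescoping sum
  have htel : Real.log (s j) - Real.log (s 0) - j * Real.log lam
      = ∑ k ∈ range j, (Real.log (s (k + 1)) - Real.log (s k) - Real.log lam) := by
    rw [Finset.sum_sub_distrib, Finset.sum_range_sub (fun k => Real.log (s k)) j,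
      Finset.sum_const, Finset.card_range, nsmul_eq_mul]
  rw [hlogP, htel, Finset.mul_sum, ← Finset.sum_sub_distrib]
  -- termwise bound
  have hterm : ∀ k ∈ range j, |Real.log (1 - γh * β k * s k)
      - γh * (Real.log (s (k + 1)) - Real.log (s k) - Real.log lam)|
      ≤ 4 * sbar * |βW k - β k| + (16 * B ^ 2 + 4 * R) * sbar ^ 2 := by
    intro k hk
    have hkj : k < j := Finset.mem_range.mp hk
    have hkJ : k < Jm := lt_of_lt_of_le hkj hj
    exact Slade2017_lem811_step hγ0 hγ1 hlam hsbar hB hR hBs hRs (hs k hkJ.le).1 (hs k hkJ.le).2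
      (hs (k + 1) (Nat.succ_le_of_lt hkJ)).1 (hβ k hkJ) (hβW k hkJ) (hrec k hkJ) (hr k hkJ)
  calc _ ≤ ∑ k ∈ range j, |Real.log (1 - γh * β k * s k)
          - γh * (Real.log (s (k + 1)) - Real.log (s k) - Real.log lam)| :=
        Finset.abs_sum_le_sum_abs _ _
    _ ≤ ∑ k ∈ range j, (4 * sbar * |βW k - β k| + (16 * B ^ 2 + 4 * R) * sbar ^ 2) :=
        Finset.sum_le_sum hterm
    _ = 4 * sbar * ∑ k ∈ range j, |βW k - β k| + (16 * B ^ 2 + 4 * R) * sbar ^ 2 * j := by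
        rw [Finset.sum_add_distrib, Finset.mul_sum, Finset.sum_const, Finset.card_range,
          nsmul_eq_mul]
        ring
    _ ≤ 4 * sbar * S + (16 * B ^ 2 + 4 * R) * sbar ^ 2 * j := by
        gcongr
        calc ∑ k ∈ range j, |βW k - β k| ≤ ∑ k ∈ range Jm, |βW k - β k| := by
              apply Finset.sum_le_sum_of_subset_of_nonneg (Finset.range_mono hj)
              intro i _ _
              exact abs_nonneg _
          _ ≤ S := hdiff
    _ = 4 * S * sbar + (16 * B ^ 2 + 4 * R) * sbar ^ 2 * j := by ring

/-- Under the hypotheses of Lemma 8.1.1 every factor `1 - γ̂β_k s_k` is at least `¾`, so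
`P_j > 0` for `j ≤ Jm`. [cite: Slade2017, Lemma 8.1.1 (proof)] -/
theorem flowP_pos_of
    {γh sbar B : ℝ} {β s : ℕ → ℝ} {Jm : ℕ}
    (hγ0 : 0 ≤ γh) (hγ1 : γh ≤ 1) (hsbar : 0 < sbar) (hB : 0 ≤ B)
    (hBs : 2 * B * sbar ≤ 1 / 4)
    (hs : ∀ k ≤ Jm, sbar / 2 ≤ s k ∧ s k ≤ 2 * sbar)
    (hβ : ∀ k < Jm, |β k| ≤ B) :
    ∀ j ≤ Jm, 0 < flowP γh β s j := by
  intro j hj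
  induction j with
  | zero => simp [flowP_zero]
  | succ i ih =>
    rw [flowP_succ]
    have hiJ : i < Jm := Nat.lt_of_succ_le hj
    have hsi := hs i hiJ.le
    have hsi0 : 0 < s i := by linarith [hsi.1]
    have h1 : |γh * β i * s i| ≤ 1 / 4 := by
      rw [abs_mul, abs_mul, abs_of_nonneg hγ0, abs_of_pos hsi0]
      calc γh * |β i| * s i ≤ 1 * B * (2 * sbar) := by
            apply mul_le_mul (mul_le_mul hγ1 (hβ i hiJ) (abs_nonneg _) zero_le_one) hsi.2
              hsi0.le (by positivity)
        _ = 2 * B * sbar := by ring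
        _ ≤ 1 / 4 := hBs
    have := le_abs_self (γh * β i * s i)
    exact mul_pos (ih hiJ.le) (by linarith)

/-- **Slade, Lemma 8.1.1 (printed product form).** Under the hypotheses of
`Slade2017_lem811_log`, for `j ≤ Jm`:
`e^{-E_j} (lam^{-j}s_j/s_0)^γ̂ ≤ P_j ≤ e^{E_j} (lam^{-j}s_j/s_0)^γ̂`, `E_j = 4Ss̄ + (16B²+4R)s̄²j`
— "`P_j = (1+O(s̄))(L^{-εj}s_j/s_0)^γ̂ e^{O(s̄²j)}`" with `lam = L^ε`.
[cite: Slade2017, Lemma 8.1.1 (first equality)] -/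
theorem Slade2017_lem811
    {γh lam sbar B S R : ℝ} {β βW s r : ℕ → ℝ} {Jm : ℕ}
    (hγ0 : 0 ≤ γh) (hγ1 : γh ≤ 1) (hlam : 1 ≤ lam) (hsbar : 0 < sbar)
    (hB : 0 ≤ B) (hR : 0 ≤ R)
    (hBs : 2 * B * sbar ≤ 1 / 4) (hRs : 2 * R * sbar ^ 2 ≤ 1 / 4)
    (hs : ∀ k ≤ Jm, sbar / 2 ≤ s k ∧ s k ≤ 2 * sbar)
    (hβ : ∀ k < Jm, |β k| ≤ B) (hβW : ∀ k < Jm, |βW k| ≤ B)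
    (hdiff : ∑ k ∈ range Jm, |βW k - β k| ≤ S)
    (hrec : ∀ k < Jm, s (k + 1) = lam * (1 - βW k * s k) * s k + r k)
    (hr : ∀ k < Jm, |r k| ≤ R * sbar ^ 3) :
    ∀ j ≤ Jm,
      Real.exp (-(4 * S * sbar + (16 * B ^ 2 + 4 * R) * sbar ^ 2 * j))
          * (lam ^ (-(j : ℝ)) * s j / s 0) ^ γh ≤ flowP γh β s j ∧
      flowP γh β s j ≤ Real.exp (4 * S * sbar + (16 * B ^ 2 + 4 * R) * sbar ^ 2 * j)
          * (lam ^ (-(j : ℝ)) * s j / s 0) ^ γh := by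
  intro j hj
  have hmain := Slade2017_lem811_log hγ0 hγ1 hlam hsbar hB hR hBs hRs hs hβ hβW hdiff hrec hr j hj
  have hP := flowP_pos_of hγ0 hγ1 hsbar hB hBs hs hβ j hj
  have hlam0 : 0 < lam := by linarith
  have hsj : 0 < s j := by linarith [(hs j hj).1]
  have hs0 : 0 < s 0 := by linarith [(hs 0 (Nat.zero_le _)).1]
  have hQ : 0 < lam ^ (-(j : ℝ)) * s j / s 0 := by positivity
  have hlogQ : Real.log ((lam ^ (-(j : ℝ)) * s j / s 0) ^ γh)
      = γh * (Real.log (s j) - Real.log (s 0) - j * Real.log lam) := by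
    rw [Real.log_rpow hQ, Real.log_div (by positivity) hs0.ne', Real.log_mul (by positivity) hsj.ne',
      Real.log_rpow hlam0]
    ring
  set E := 4 * S * sbar + (16 * B ^ 2 + 4 * R) * sbar ^ 2 * j
  have hQγ : 0 < (lam ^ (-(j : ℝ)) * s j / s 0) ^ γh := Real.rpow_pos_of_pos hQ _
  rw [abs_sub_le_iff] at hmain
  constructor
  · -- lower bound
    rw [← Real.exp_log hP, ← Real.exp_log hQγ, ← Real.exp_add]
    apply Real.exp_le_exp.mpr
    rw [hlogQ]; linarith [hmain.2]
  · rw [← Real.exp_log hP, ← Real.exp_log hQγ, ← Real.exp_add]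
    apply Real.exp_le_exp.mpr
    rw [hlogQ]; linarith [hmain.1]

/-- **Slade, Lemma 8.1.1, second equality.** "The second equality in [the lemma] follows from the
first, together with the fact that `g_j = L^{-εj}s_j(1+O(s̄))` by [the definitions
`ĝ_j = L^{εj}g_j` of §5.3 and of the transformation `T`]": if moreover
`|log g_k - (log s_k - k log lam)| ≤ Ks̄` for `k ≤ Jm` (`ĝ_k = L^{εk}g_k`,
`s_k = ĝ_k(1 + 4(μ̂_k + η_{≥k}ĝ_k)w̄_k^{(1)})`), then
`|log P_j - γ̂(log g_j - log g_0)| ≤ 2Ks̄ + 4Ss̄ + (16B²+4R)s̄²j` for `j ≤ Jm`.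
[cite: Slade2017, Lemma 8.1.1 (second equality) and §5.3 (definitions of `ĝ_j` and `T`)] -/
theorem Slade2017_lem811_g
    {γh lam sbar B S R K : ℝ} {β βW s r g : ℕ → ℝ} {Jm : ℕ}
    (hγ0 : 0 ≤ γh) (hγ1 : γh ≤ 1) (hlam : 1 ≤ lam) (hsbar : 0 < sbar)
    (hB : 0 ≤ B) (hR : 0 ≤ R)
    (hBs : 2 * B * sbar ≤ 1 / 4) (hRs : 2 * R * sbar ^ 2 ≤ 1 / 4)
    (hs : ∀ k ≤ Jm, sbar / 2 ≤ s k ∧ s k ≤ 2 * sbar)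
    (hβ : ∀ k < Jm, |β k| ≤ B) (hβW : ∀ k < Jm, |βW k| ≤ B)
    (hdiff : ∑ k ∈ range Jm, |βW k - β k| ≤ S)
    (hrec : ∀ k < Jm, s (k + 1) = lam * (1 - βW k * s k) * s k + r k)
    (hr : ∀ k < Jm, |r k| ≤ R * sbar ^ 3)
    (hg : ∀ k ≤ Jm, |Real.log (g k) - (Real.log (s k) - k * Real.log lam)| ≤ K * sbar) :
    ∀ j ≤ Jm, |Real.log (flowP γh β s j) - γh * (Real.log (g j) - Real.log (g 0))|
      ≤ 2 * K * sbar + 4 * S * sbar + (16 * B ^ 2 + 4 * R) * sbar ^ 2 * j := by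
  intro j hj
  have hmain := Slade2017_lem811_log hγ0 hγ1 hlam hsbar hB hR hBs hRs hs hβ hβW hdiff hrec hr j hj
  have hgj := hg j hj
  have hg0 := hg 0 (Nat.zero_le _)
  simp only [Nat.cast_zero, zero_mul, sub_zero] at hg0
  have hsplit : Real.log (flowP γh β s j) - γh * (Real.log (g j) - Real.log (g 0))
      = (Real.log (flowP γh β s j) - γh * (Real.log (s j) - Real.log (s 0) - j * Real.log lam))
        - γh * (Real.log (g j) - (Real.log (s j) - j * Real.log lam))
        + γh * (Real.log (g 0) - Real.log (s 0)) := by ring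
  rw [hsplit]
  have h1 : |γh * (Real.log (g j) - (Real.log (s j) - j * Real.log lam))| ≤ K * sbar := by
    rw [abs_mul, abs_of_nonneg hγ0]
    calc γh * |Real.log (g j) - (Real.log (s j) - j * Real.log lam)| ≤ 1 * (K * sbar) :=
          mul_le_mul hγ1 hgj (abs_nonneg _) zero_le_one
      _ = K * sbar := one_mul _
  have h2 : |γh * (Real.log (g 0) - Real.log (s 0))| ≤ K * sbar := by
    rw [abs_mul, abs_of_nonneg hγ0]
    calc γh * |Real.log (g 0) - Real.log (s 0)| ≤ 1 * (K * sbar) :=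
          mul_le_mul hγ1 hg0 (abs_nonneg _) zero_le_one
      _ = K * sbar := one_mul _
  calc _ ≤ |(Real.log (flowP γh β s j) - γh * (Real.log (s j) - Real.log (s 0) - j * Real.log lam))
        - γh * (Real.log (g j) - (Real.log (s j) - j * Real.log lam))|
        + |γh * (Real.log (g 0) - Real.log (s 0))| := abs_add_le _ _
    _ ≤ (|Real.log (flowP γh β s j) - γh * (Real.log (s j) - Real.log (s 0) - j * Real.log lam)|
        + |γh * (Real.log (g j) - (Real.log (s j) - j * Real.log lam))|)
        + |γh * (Real.log (g 0) - Real.log (s 0))| := by gcongr; exact abs_sub _ _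
    _ ≤ ((4 * S * sbar + (16 * B ^ 2 + 4 * R) * sbar ^ 2 * j) + K * sbar) + K * sbar := by
        gcongr
    _ = 2 * K * sbar + 4 * S * sbar + (16 * B ^ 2 + 4 * R) * sbar ^ 2 * j := by ring

/-! ### The mass scale (§3.4) -/

/-- `f_m = 1 + α⁻¹ log_L m⁻²` (the real-valued mass scale; `m2 = m²`).
[cite: Slade2017, §3.4 (display defining the mass scale `j_m = ⌈f_m⌉`)] -/
def massScaleReal (L α m2 : ℝ) : ℝ := 1 + Real.log m2⁻¹ / (α * Real.log L)

/-- The mass scale `j_m = ⌈f_m⌉`, "the smallest scale `j_m = j_m(L)` for which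
`m²L^{α(j_m-1)} ≥ 1`". [cite: Slade2017, §3.4 (display defining the mass scale)] -/
def massScale (L α m2 : ℝ) : ℕ := ⌈massScaleReal L α m2⌉₊

/-- `f_m ≥ 1` for `m² ≤ 1` (`L > 1`, `α > 0`). [cite: Slade2017, §3.4 (display defining the mass scale)] -/
theorem massScaleReal_pos {L α m2 : ℝ} (hL : 1 < L) (hα : 0 < α) (hm : 0 < m2) (hm1 : m2 ≤ 1) :
    1 ≤ massScaleReal L α m2 := by
  unfold massScaleReal
  have hlogL : 0 < Real.log L := Real.log_pos hL
  have hlm : 0 ≤ Real.log m2⁻¹ := Real.log_nonneg (one_le_inv₀ hm |>.mpr hm1)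
  have : 0 ≤ Real.log m2⁻¹ / (α * Real.log L) := by positivity
  linarith

/-- `f_m ≤ j_m`. [cite: Slade2017, §3.4 (display defining the mass scale)] -/
theorem massScale_ge {L α m2 : ℝ} : massScaleReal L α m2 ≤ (massScale L α m2 : ℝ) :=
  Nat.le_ceil _

/-- `j_m < f_m + 1`. [cite: Slade2017, §3.4 (display defining the mass scale)] -/
theorem massScale_lt {L α m2 : ℝ} (hL : 1 < L) (hα : 0 < α) (hm : 0 < m2) (hm1 : m2 ≤ 1) :
    (massScale L α m2 : ℝ) < massScaleReal L α m2 + 1 :=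
  Nat.ceil_lt_add_one (by linarith [massScaleReal_pos hL hα hm hm1])

/-- **The mass scale in terms of the mass:** `L^{-αj_m} ≤ L^{-α}m²` (i.e. `m²L^{α(j_m-1)} ≥ 1`,
the defining property) and `L^{-αj_m} ≥ L^{-2α}m²` (minimality of `j_m`), for
`0 < m² ≤ 1`, `L > 1`, `α > 0`. This is the conversion `L^{-αj_m} ≍ m²` used throughout §7.3–§8.2
("`L^{-εj_m}s̄ ≍ m^{2ε/α}ε`", "since `L^{-αj_m} = O(m²)`").
[cite: Slade2017, §3.4 (the mass scale and the display following its definition)] -/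
theorem Slade2017_massScale_bounds {L α m2 : ℝ} (hL : 1 < L) (hα : 0 < α) (hm : 0 < m2) (hm1 : m2 ≤ 1) :
    L ^ (-(α * massScale L α m2)) ≤ L ^ (-α) * m2 ∧
      L ^ (-(2 * α)) * m2 ≤ L ^ (-(α * massScale L α m2)) := by
  have hL0 : 0 < L := by linarith
  have hlogL : 0 < Real.log L := Real.log_pos hL
  set j : ℝ := (massScale L α m2 : ℝ) with hj
  have hjl : massScaleReal L α m2 ≤ j := massScale_ge
  have hju : j < massScaleReal L α m2 + 1 := massScale_lt hL hα hm hm1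
  have hf : massScaleReal L α m2 * (α * Real.log L) = α * Real.log L + Real.log m2⁻¹ := by
    unfold massScaleReal
    field_simp
  have hlm : Real.log m2⁻¹ = -Real.log m2 := Real.log_inv m2
  have e1 : L ^ (-(α * j)) = Real.exp (-(α * j) * Real.log L) := by
    rw [Real.rpow_def_of_pos hL0]; ring_nf
  have e2 : L ^ (-α) * m2 = Real.exp (-α * Real.log L + Real.log m2) := by
    rw [Real.exp_add, Real.exp_log hm, Real.rpow_def_of_pos hL0]; ring_nf
  have e3 : L ^ (-(2 * α)) * m2 = Real.exp (-(2 * α) * Real.log L + Real.log m2) := by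
    rw [Real.exp_add, Real.exp_log hm, Real.rpow_def_of_pos hL0]; ring_nf
  have hαl : 0 < α * Real.log L := by positivity
  have k1 : massScaleReal L α m2 * (α * Real.log L) ≤ j * (α * Real.log L) :=
    mul_le_mul_of_nonneg_right hjl hαl.le
  have k2 : j * (α * Real.log L) ≤ (massScaleReal L α m2 + 1) * (α * Real.log L) :=
    mul_le_mul_of_nonneg_right hju.le hαl.le
  constructor
  · rw [e1, e2]
    apply Real.exp_le_exp.mpr
    nlinarith [k1, hf, hlm]
  · rw [e1, e3]
    apply Real.exp_le_exp.mpr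
    nlinarith [k2, hf, hlm]

/-! ### The exponent `γ̂ε/α` at the mass scale -/

/-- **Identification of the exponent (last display of the proof of Proposition 8.2.2):**
"`L^{-γ̂εj_m} e^{O(ε²j_m)} ≍ m^{2γ̂ε/α+O(ε²)}`", quantitatively. If `ν > 0` satisfies
`|log ν + γ̂εj log L| ≤ A + cε²j` at a scale `j` with `f_m ≤ j ≤ f_m + 1` (e.g. `j = j_m`,
`Slade2017_massScale_ge/lt`), `0 < m² ≤ 1`, then
`C⁻¹(m²)^{γ̂ε/α + c'ε²} ≤ ν ≤ C(m²)^{γ̂ε/α - c'ε²}` with `C = exp(A + 2cε² + 2γ̂ε log L)` and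
`c' = c/(α log L)` (so `C` is uniform in `m²`, and in `ε ≤ 1` once `L` is fixed — the printed
order "first `L` is chosen large, and then `ε` is chosen small depending on `L`").
[cite: Slade2017, Proposition 8.2.2 (proof, last display) and §3.4 (mass scale)] -/
theorem Slade2017_exponent_identification {L α ε γh A c m2 ν : ℝ} {j : ℕ}
    (hL : 1 < L) (hα : 0 < α) (hε : 0 ≤ ε) (hγ0 : 0 ≤ γh) (hc : 0 ≤ c)
    (hm : 0 < m2) (hm1 : m2 ≤ 1) (hν : 0 < ν)
    (hjl : massScaleReal L α m2 ≤ j) (hju : (j : ℝ) ≤ massScaleReal L α m2 + 1)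
    (hlog : |Real.log ν + γh * ε * j * Real.log L| ≤ A + c * ε ^ 2 * j) :
    (Real.exp (A + 2 * c * ε ^ 2 + 2 * γh * ε * Real.log L))⁻¹
        * m2 ^ (γh * ε / α + c / (α * Real.log L) * ε ^ 2) ≤ ν ∧
      ν ≤ Real.exp (A + 2 * c * ε ^ 2 + 2 * γh * ε * Real.log L)
        * m2 ^ (γh * ε / α - c / (α * Real.log L) * ε ^ 2) := by
  have hL0 : 0 < L := by linarith
  have hlogL : 0 < Real.log L := Real.log_pos hL
  set lg := Real.log L with hlg
  set ℓ := Real.log m2⁻¹ with hℓ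
  have hℓ0 : 0 ≤ ℓ := Real.log_nonneg (one_le_inv₀ hm |>.mpr hm1)
  have hlm : Real.log m2 = -ℓ := by rw [hℓ, Real.log_inv]; ring
  set J := (j : ℝ) * lg with hJ
  -- `f_m lg = lg + ℓ/α`
  have hf : massScaleReal L α m2 * lg = lg + ℓ / α := by
    unfold massScaleReal; rw [← hℓ, ← hlg]; field_simp
  have hJl : lg + ℓ / α ≤ J := by
    rw [← hf, hJ]; exact mul_le_mul_of_nonneg_right hjl hlogL.le
  have hJu : J ≤ 2 * lg + ℓ / α := by
    have := mul_le_mul_of_nonneg_right hju hlogL.le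
    rw [add_mul, hf, one_mul] at this
    rw [hJ]; linarith
  -- bounds on `j` itself: `j ≤ f + 1 = 2 + ℓ/(α lg)`
  have hj2 : (j : ℝ) ≤ 2 + ℓ / (α * lg) := by
    have : massScaleReal L α m2 = 1 + ℓ / (α * lg) := rfl
    linarith
  have hγε : 0 ≤ γh * ε := mul_nonneg hγ0 hε
  have hcε : 0 ≤ c * ε ^ 2 := by positivity
  have i1 : γh * ε * (lg + ℓ / α) ≤ γh * ε * J := mul_le_mul_of_nonneg_left hJl hγε
  have i2 : γh * ε * J ≤ γh * ε * (2 * lg + ℓ / α) := mul_le_mul_of_nonneg_left hJu hγε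
  have i3 : c * ε ^ 2 * j ≤ c * ε ^ 2 * (2 + ℓ / (α * lg)) := mul_le_mul_of_nonneg_left hj2 hcε
  have hlog' : |Real.log ν + γh * ε * J| ≤ A + c * ε ^ 2 * j := by
    rw [hJ]; convert hlog using 2; ring
  rw [abs_le] at hlog'
  have hγlg : 0 ≤ γh * ε * lg := by positivity
  -- rewrite both sides as exponentials
  have eU : Real.exp (A + 2 * c * ε ^ 2 + 2 * γh * ε * lg)
      * m2 ^ (γh * ε / α - c / (α * lg) * ε ^ 2)
      = Real.exp (A + 2 * c * ε ^ 2 + 2 * γh * ε * lg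
          + (γh * ε / α - c / (α * lg) * ε ^ 2) * (-ℓ)) := by
    rw [Real.rpow_def_of_pos hm, hlm, ← Real.exp_add]; congr 1; ring
  have eL : (Real.exp (A + 2 * c * ε ^ 2 + 2 * γh * ε * lg))⁻¹
      * m2 ^ (γh * ε / α + c / (α * lg) * ε ^ 2)
      = Real.exp (-(A + 2 * c * ε ^ 2 + 2 * γh * ε * lg)
          + (γh * ε / α + c / (α * lg) * ε ^ 2) * (-ℓ)) := by
    rw [← Real.exp_neg, Real.rpow_def_of_pos hm, hlm, ← Real.exp_add]; congr 1; ring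
  have key1 : c * ε ^ 2 * (2 + ℓ / (α * lg)) = 2 * c * ε ^ 2 + c / (α * lg) * ε ^ 2 * ℓ := by
    field_simp
  have key2 : γh * ε * (lg + ℓ / α) = γh * ε * lg + γh * ε / α * ℓ := by
    field_simp
  have key3 : γh * ε * (2 * lg + ℓ / α) = 2 * (γh * ε * lg) + γh * ε / α * ℓ := by
    field_simp
  constructor
  · rw [eL, ← Real.exp_log hν]
    apply Real.exp_le_exp.mpr
    nlinarith [hlog'.1, i2, i3, key1, key3]
  · rw [eU, ← Real.exp_log hν]
    apply Real.exp_le_exp.mpr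
    nlinarith [hlog'.2, i1, i3, key1, key2, hγlg]

/-- **The display after Remark 8.2.3, given the flow.** Assume the inputs of Lemma 8.1.1 up to
the mass scale `Jm = j_m(L,α,m²)` with `lam = L^ε` (`L > 1`, `0 < ε ≤ 1`, `α > 0`), `γ̂ ∈ [0,1]`,
`s̄ ≤ c₀ε` ("`s̄ = a⁻¹(1-L^{-ε}) = O(ε)`", §5.4), `0 < m² ≤ 1`, and let `ν > 0` satisfy
`|log ν - log P_{j_m}| ≤ A₁ + c₁s̄²j_m` ("`ν'_∞ ≍ P_{j_m}e^{O(ε²j_m)}`", from Theorem 7.3.1,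
Corollary 8.1.3 and Lemma 8.1.4 — an output of the renormalisation-group flow, taken here as a
hypothesis). Then
`C⁻¹(m²)^{γ̂ε/α + c'ε²} ≤ ν ≤ C(m²)^{γ̂ε/α - c'ε²}` with
`C = exp(log 4 + 4Sc₀ + A₁ + 2(16B²+4R+c₁)c₀² + 2 log L)` and `c' = (16B²+4R+c₁)c₀²/(α log L)`,
constants independent of `m²` and `ε` — "`ν'_∞ ≍ m^{2γ̂ε/α+O(ε²)}`", equivalently (with
`χ̂' = -ν'_∞/m⁴`) "`c⁻¹m^{-4+2γ̂ε/α+cε²} ≤ -∂χ/∂ν(ν*) ≤ cm^{-4+2γ̂ε/α-cε²}`".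
[cite: Slade2017, Proposition 8.2.2 (proof, last display) and first display after Remark 8.2.3] -/
theorem Slade2017_prop822_exponent_of_flow
    {γh L ε α sbar c₀ B S R A₁ c₁ m2 ν : ℝ} {β βW s r : ℕ → ℝ}
    (hγ0 : 0 ≤ γh) (hγ1 : γh ≤ 1) (hL : 1 < L) (hε : 0 < ε) (hε1 : ε ≤ 1) (hα : 0 < α)
    (hsbar : 0 < sbar) (hc₀ : sbar ≤ c₀ * ε)
    (hB : 0 ≤ B) (hR : 0 ≤ R) (hS : 0 ≤ S) (hc₁ : 0 ≤ c₁)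
    (hBs : 2 * B * sbar ≤ 1 / 4) (hRs : 2 * R * sbar ^ 2 ≤ 1 / 4)
    (hm : 0 < m2) (hm1 : m2 ≤ 1)
    (hs : ∀ k ≤ massScale L α m2, sbar / 2 ≤ s k ∧ s k ≤ 2 * sbar)
    (hβ : ∀ k < massScale L α m2, |β k| ≤ B) (hβW : ∀ k < massScale L α m2, |βW k| ≤ B)
    (hdiff : ∑ k ∈ range (massScale L α m2), |βW k - β k| ≤ S)
    (hrec : ∀ k < massScale L α m2, s (k + 1) = L ^ ε * (1 - βW k * s k) * s k + r k)
    (hr : ∀ k < massScale L α m2, |r k| ≤ R * sbar ^ 3)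
    (hν : 0 < ν)
    (hνP : |Real.log ν - Real.log (flowP γh β s (massScale L α m2))|
      ≤ A₁ + c₁ * sbar ^ 2 * massScale L α m2) :
    (Real.exp (Real.log 4 + 4 * S * c₀ + A₁ + 2 * ((16 * B ^ 2 + 4 * R + c₁) * c₀ ^ 2)
        + 2 * Real.log L))⁻¹
        * m2 ^ (γh * ε / α + (16 * B ^ 2 + 4 * R + c₁) * c₀ ^ 2 / (α * Real.log L) * ε ^ 2)
        ≤ ν ∧
      ν ≤ Real.exp (Real.log 4 + 4 * S * c₀ + A₁ + 2 * ((16 * B ^ 2 + 4 * R + c₁) * c₀ ^ 2)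
        + 2 * Real.log L)
        * m2 ^ (γh * ε / α - (16 * B ^ 2 + 4 * R + c₁) * c₀ ^ 2 / (α * Real.log L) * ε ^ 2) := by
  set Jm := massScale L α m2 with hJm
  have hL0 : 0 < L := by linarith
  have hlogL : 0 < Real.log L := Real.log_pos hL
  have hlam : 1 ≤ L ^ ε := Real.one_le_rpow hL.le hε.le
  have hloglam : Real.log (L ^ ε) = ε * Real.log L := Real.log_rpow hL0 ε
  have h811 := Slade2017_lem811_log hγ0 hγ1 hlam hsbar hB hR hBs hRs hs hβ hβW hdiff hrec hr Jm le_rfl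
  rw [hloglam] at h811
  -- `|log s_J - log s_0| ≤ log 4`
  have hsJ := hs Jm le_rfl
  have hs0 := hs 0 (Nat.zero_le _)
  have hsJ0 : 0 < s Jm := by linarith [hsJ.1]
  have hs00 : 0 < s 0 := by linarith [hs0.1]
  have hlog4 : |Real.log (s Jm) - Real.log (s 0)| ≤ Real.log 4 := by
    have e4 : Real.log 4 = Real.log (2 * sbar) - Real.log (sbar / 2) := by
      rw [← Real.log_div (by positivity) (by positivity)]
      congr 1; field_simp; norm_num
    rw [abs_le, e4]
    constructor
    · have h1 : Real.log (sbar / 2) ≤ Real.log (s Jm) := Real.log_le_log (by positivity) hsJ.1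
      have h2 : Real.log (s 0) ≤ Real.log (2 * sbar) := Real.log_le_log hs00 hs0.2
      linarith
    · have h1 : Real.log (s Jm) ≤ Real.log (2 * sbar) := Real.log_le_log hsJ0 hsJ.2
      have h2 : Real.log (sbar / 2) ≤ Real.log (s 0) := Real.log_le_log (by positivity) hs0.1
      linarith
  -- `s̄ ≤ c₀ ε ≤ c₀`, `s̄² ≤ c₀² ε²`
  have hc₀pos : 0 < c₀ := by
    by_contra h
    have h' : c₀ ≤ 0 := not_lt.mp h
    have : c₀ * ε ≤ 0 := mul_nonpos_of_nonpos_of_nonneg h' hε.le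
    linarith
  have hsc : sbar ≤ c₀ := hc₀.trans (by nlinarith)
  have hs2 : sbar ^ 2 ≤ c₀ ^ 2 * ε ^ 2 := by
    rw [← mul_pow]; exact pow_le_pow_left₀ hsbar.le hc₀ 2
  -- the combined logarithmic bound
  set A := Real.log 4 + 4 * S * c₀ + A₁ with hA
  set c := (16 * B ^ 2 + 4 * R + c₁) * c₀ ^ 2 with hc
  have hcnn : 0 ≤ c := by positivity
  have hJnn : (0 : ℝ) ≤ Jm := Nat.cast_nonneg _
  have hcomb : |Real.log ν + γh * ε * Jm * Real.log L| ≤ A + c * ε ^ 2 * Jm := by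
    have hsplit : Real.log ν + γh * ε * Jm * Real.log L
        = (Real.log ν - Real.log (flowP γh β s Jm))
          + (Real.log (flowP γh β s Jm)
              - γh * (Real.log (s Jm) - Real.log (s 0) - Jm * (ε * Real.log L)))
          + γh * (Real.log (s Jm) - Real.log (s 0)) := by ring
    rw [hsplit]
    have hγlog : |γh * (Real.log (s Jm) - Real.log (s 0))| ≤ Real.log 4 := by
      rw [abs_mul, abs_of_nonneg hγ0]
      calc γh * |Real.log (s Jm) - Real.log (s 0)| ≤ 1 * Real.log 4 :=
            mul_le_mul hγ1 hlog4 (abs_nonneg _) zero_le_one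
        _ = Real.log 4 := one_mul _
    have t1 : 4 * S * sbar ≤ 4 * S * c₀ := by nlinarith
    have t2 : (16 * B ^ 2 + 4 * R) * sbar ^ 2 * Jm ≤ (16 * B ^ 2 + 4 * R) * (c₀ ^ 2 * ε ^ 2) * Jm := by
      apply mul_le_mul_of_nonneg_right _ hJnn
      exact mul_le_mul_of_nonneg_left hs2 (by positivity)
    have t3 : c₁ * sbar ^ 2 * Jm ≤ c₁ * (c₀ ^ 2 * ε ^ 2) * Jm := by
      apply mul_le_mul_of_nonneg_right _ hJnn
      exact mul_le_mul_of_nonneg_left hs2 hc₁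
    calc _ ≤ |(Real.log ν - Real.log (flowP γh β s Jm))
          + (Real.log (flowP γh β s Jm)
              - γh * (Real.log (s Jm) - Real.log (s 0) - Jm * (ε * Real.log L)))|
          + |γh * (Real.log (s Jm) - Real.log (s 0))| := abs_add_le _ _
      _ ≤ (|Real.log ν - Real.log (flowP γh β s Jm)|
          + |Real.log (flowP γh β s Jm)
              - γh * (Real.log (s Jm) - Real.log (s 0) - Jm * (ε * Real.log L))|)
          + |γh * (Real.log (s Jm) - Real.log (s 0))| := by gcongr; exact abs_add_le _ _
      _ ≤ ((A₁ + c₁ * sbar ^ 2 * Jm) + (4 * S * sbar + (16 * B ^ 2 + 4 * R) * sbar ^ 2 * Jm))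
          + Real.log 4 := by gcongr
      _ ≤ A + c * ε ^ 2 * Jm := by rw [hA, hc]; linarith [t1, t2, t3]
  -- apply the exponent identification at `j = j_m`
  have hid := Slade2017_exponent_identification hL hα hε.le hγ0 hcnn hm hm1 hν
    (massScale_ge (L := L) (α := α) (m2 := m2)) (massScale_lt hL hα hm hm1).le hcomb
  -- weaken the constant `exp(A + 2cε² + 2γ̂ε log L) ≤ exp(A + 2c + 2 log L)`
  have hCle : Real.exp (A + 2 * c * ε ^ 2 + 2 * γh * ε * Real.log L)
      ≤ Real.exp (A + 2 * c + 2 * Real.log L) := by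
    apply Real.exp_le_exp.mpr
    have e1 : ε ^ 2 ≤ 1 := pow_le_one₀ hε.le hε1
    have e2 : γh * ε ≤ 1 := by
      calc γh * ε ≤ 1 * 1 := mul_le_mul hγ1 hε1 hε.le zero_le_one
        _ = 1 := one_mul _
    have e3 : c * ε ^ 2 ≤ c * 1 := mul_le_mul_of_nonneg_left e1 hcnn
    have e4 : γh * ε * Real.log L ≤ 1 * Real.log L := mul_le_mul_of_nonneg_right e2 hlogL.le
    linarith
  have hmpos1 : 0 < m2 ^ (γh * ε / α + c / (α * Real.log L) * ε ^ 2) := Real.rpow_pos_of_pos hm _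
  have hmpos2 : 0 < m2 ^ (γh * ε / α - c / (α * Real.log L) * ε ^ 2) := Real.rpow_pos_of_pos hm _
  have hCpos : 0 < Real.exp (A + 2 * c * ε ^ 2 + 2 * γh * ε * Real.log L) := Real.exp_pos _
  refine ⟨?_, ?_⟩
  · calc _ ≤ (Real.exp (A + 2 * c * ε ^ 2 + 2 * γh * ε * Real.log L))⁻¹
          * m2 ^ (γh * ε / α + c / (α * Real.log L) * ε ^ 2) := by
          rw [hc]
          apply mul_le_mul_of_nonneg_right _ hmpos1.le
          rw [← hc]
          exact inv_anti₀ hCpos hCle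
      _ ≤ ν := hid.1
  · calc ν ≤ _ := hid.2
      _ ≤ _ := by
          rw [hc]
          apply mul_le_mul_of_nonneg_right _ hmpos2.le
          rw [← hc]; exact hCle

/-- `γ̂ = (n+2)/(n+8) ∈ [0,1]` (§5.1), so the lemmas above apply with `γh = γ̂`.
[cite: Slade2017, §5.1 (display defining `γ̂`)] -/
theorem gammaHat_mem_unitInterval (n : ℕ) :
    0 ≤ ((n : ℝ) + 2) / ((n : ℝ) + 8) ∧ ((n : ℝ) + 2) / ((n : ℝ) + 8) ≤ 1 := by
  have hn : (0 : ℝ) ≤ n := Nat.cast_nonneg n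
  constructor
  · positivity
  · rw [div_le_one (by positivity)]; linarith

end LongRangePhi4

end Literature.Barriers.CriticalPhenomena

end
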